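import Summits.CriticalPhenomena.Ising3D.Control2DTaylorPairs
import Summits.CriticalPhenomena.Ising3D.Control2DTruncation
import Summits.CriticalPhenomena.Ising3D.TaylorCoeffZMono
import Mathlib.Tactic.Linarith
import Mathlib.Tactic.Positivity
import Mathlib.Tactic.Ring
import HarnessLib

/-!
# Closed form of a 2D derivative functional on a pair monomial: what a γ-certificate's table reproduces
(cell `pub-ising3x`, seat controls-1 gen 14; KERNEL PATH for the 2D γ (derivative-functional)
certificates, step 2a — CONTROL-ONLY)

HONEST FRAMING: lottery ticket; floor = tightest certified 3D Ising CFT bounds; no exact-solution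
claim without a proof. CONTROL-ONLY (`d = 2`); nothing numerical is asserted here.

After `Control2DTaylorSound` a 2D derivative-functional certificate proves its typed statement once its
finitely many OBLIGATIONS are established for the Taylor functional `φ = ∑_{(m,n) ∈ S} w_{mn} · T_{(m,n)}`
(`T_{(m,n)}` = boot-1's `taylorCoeffAt x x (m,n)`, the `h^m k^n` Taylor coefficient at the diagonal
point; the readers' `α_{mn} ∂_z^m ∂_z̄^n|_{1/2}` up to `m! n!`). The obligations above `E₀` and the
cells reduce (`high_nonneg_of_pairPositive_taylor`, the block's pair-monomial series) to the values of
`φ` on the crossing terms `F^{s}_σ[x^a y^b + x^b y^a]`, `a - b = J ∈ ℕ`. This file makes those values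
EXPLICIT AND FINITE — the 2D twin of boot-1's `taylorCoeffAt_crossF_zMono` (g0′), with the 3D
polynomial `𝒫_j` replaced by `z^J + z̄^J`:

* `hasTaylorGerm_crossF_pairPow`, `taylorCoeffAt_crossF_pairPow`: for `b ≥ 0`, `J ∈ ℕ`, `0 < x < 1`,
  `T_{(m,n)}(F^{s}_σ[pairPow (b+J) b]) = c¹_J(m) c¹_0(n) + c¹_0(m) c¹_J(n) + σ (c²_J(m) c²_0(n) + c²_0(m) c²_J(n))`,
  `c¹_i(m) = factor₁Germ s (b+i) x m` (germ of `(1-z)^s z^{b+i}`), `c²_i(m) = factor₂Germ s (b+i) x m`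
  (germ of `z^s (1-z)^{b+i}`) — finite sums of `Ring.choose` polynomials in `b` times the prefactors
  `x^{b+i}`, `(1-x)^{b+i}` (`rpowGerm_eq`, `oneSubGerm_eq`); at `x = 1/2` the `2^{-E} 4^{-s} Q(E, J)`
  structure of the readers' tables (`E = 2b + J`);
* `taylorCoeffAt_crossF_pairPow_symm` (the same for `a - b ∈ ℤ` of either sign),
  `taylorCoeffAt_crossF_one`: the identity term (`pairPow 0 0 = 2`);
* `phi_QN_le_block_taylor`, `blockPositive_of_QN_nonneg_taylor`: the cells below `E₀` — twin of
  `Control2DTruncation.phi_QN_le_block` for Taylor functionals (block positivity from positivity on the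
  TRUNCATED block `Q_N`, the dropped pairs being above threshold), and `taylorFunctional2D_crossF_QN`,
  the table functional's value on `F_-[Q_N]` as an explicit finite triple sum;
* `taylorFunctional2D x S w` (the typed 2D derivative functional of a table `w` on a finite index set
  `S`), `isTaylorFunctional_taylorFunctional2D`, `taylorFunctional2D_crossF_pairPow` (its value on a
  pair-monomial crossing term as the finite double sum), and `pairPositiveAbove_of_nat`: the
  above-threshold obligation `PairPositiveAbove φ s E₀` follows from its instances `a = b + J`,
  `J ∈ ℕ` (symmetry `pairPow_comm`).

So the region obligation of a 2D γ-certificate for `taylorFunctional2D (1/2) S w` is the countable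
family of explicit real inequalities `0 ≤ ∑_{(m,n)∈S} w_{mn} [closed form](b, J)` over `b ≥ 0`, `J ∈ ℕ`,
`2b + J ≥ E₀` — the object a kernel replay of the readers' Bernstein / top-form certificates must
establish (not done here). Sources: Kos–Poland–Simmons-Duffin 2014 §3.3 (derivative functionals);
boot-1's `TaylorCoeffZMono`, `BlockTaylorGerm` (tree); `Control2DTaylorPairs` (this seat).
-/

namespace Summit.CriticalPhenomena.Ising3D.Control2D

open Finset Set
open Literature.MathematicalPhysics.QuantumFieldTheory.ConformalBootstrap3D

/-! ### The Taylor germ and coefficients of `F^{s}_σ[pairPow (b+J) b]` at `(x,x)` -/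

/-- **The Taylor germ of `F^{s}_σ[pairPow (b+J) b]` at `(x,x)`, explicitly** (radius `x(1-x)`):
`dsCoeff (pairCoeff J) c¹ c¹ + σ • dsCoeff (pairCoeff J) c² c²` with `cⁱ_m = factorᵢGerm s (b+m) x`
(boot-1's `hasTaylorGerm_term₁/₂` on the block shape `(z z̄)^b (z^J + z̄^J)`). [folklore] -/
theorem hasTaylorGerm_crossF_pairPow {x : ℝ} (hx0 : 0 < x) (hx1 : x < 1) (s σ : ℝ) {b : ℝ}
    (hb : 0 ≤ b) (J : ℕ) :
    HasTaylorGerm (crossF s σ (pairPow (b + J) b)) x x (x * (1 - x))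
      (dsCoeff (pairCoeff J) (fun m => factor₁Germ s (b + m) x) (fun m => factor₁Germ s (b + m) x) +
        σ • dsCoeff (pairCoeff J) (fun m => factor₂Germ s (b + m) x)
          (fun m => factor₂Germ s (b + m) x)) := by
  have hK := isDoublePowerSeriesOn_pairK J
  have hg : ∀ z zb : ℝ, z ∈ Ioo (0 : ℝ) 1 → zb ∈ Ioo (0 : ℝ) 1 →
      pairPow (b + J) b z zb = (z * zb) ^ b * pairK J z zb :=
    fun z zb hz hzb => pairPow_eq_shape b J hz.1 hzb.1
  have h₁ := (hasTaylorGerm_term₁ hK hb hx0 hx1 hg s).1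
  have h₂ := (hasTaylorGerm_term₂ hK hb hx0 hx1 hg s).1
  have hsum := h₁.add (h₂.smul σ)
  have hfun : ((fun z zb => ((1 - z) * (1 - zb)) ^ s * pairPow (b + J) b z zb) +
      σ • fun z zb => (z * zb) ^ s * pairPow (b + J) b (1 - z) (1 - zb)) =
      crossF s σ (pairPow (b + J) b) := by
    funext z zb
    simp only [Pi.add_apply, Pi.smul_apply, smul_eq_mul, crossF]
    ring
  rw [hfun] at hsum
  exact hsum

/-- **(g0′, d = 2) Closed form.** For `0 < x < 1`, `b ≥ 0`, `J ∈ ℕ` and every `(m, n)`: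
`taylorCoeffAt x x (m,n) (F^{s}_σ[pairPow (b+J) b]) =
  c¹_J(m) c¹_0(n) + c¹_0(m) c¹_J(n) + σ (c²_J(m) c²_0(n) + c²_0(m) c²_J(n))`,
`cⁱ_i'(m) = factorᵢGerm s (b + i') x m` (for `J = 0` the two summands of each bracket coincide, matching
`pairPow b b = 2 (z z̄)^b`). A finite expression in binomial coefficients.
[cite: KosPolandSimmonsduffin2014, §3.3 eq. (3.17)] -/
theorem taylorCoeffAt_crossF_pairPow {x : ℝ} (hx0 : 0 < x) (hx1 : x < 1) (s σ : ℝ) {b : ℝ}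
    (hb : 0 ≤ b) (J : ℕ) (mn : ℕ × ℕ) :
    taylorCoeffAt x x mn (crossF s σ (pairPow (b + J) b)) =
      factor₁Germ s (b + J) x mn.1 * factor₁Germ s b x mn.2 +
          factor₁Germ s b x mn.1 * factor₁Germ s (b + J) x mn.2 +
        σ * (factor₂Germ s (b + J) x mn.1 * factor₂Germ s b x mn.2 +
          factor₂Germ s b x mn.1 * factor₂Germ s (b + J) x mn.2) := by
  rw [taylorCoeffAt_eq (hasTaylorGerm_crossF_pairPow hx0 hx1 s σ hb J) mn, Pi.add_apply,
    Pi.smul_apply, smul_eq_mul,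
    dsCoeff_eq_sum ({(J, 0), (0, J)} : Finset (ℕ × ℕ)) (fun p hp => pairCoeff_eq_zero hp),
    dsCoeff_eq_sum ({(J, 0), (0, J)} : Finset (ℕ × ℕ)) (fun p hp => pairCoeff_eq_zero hp)]
  by_cases hJ : J = 0
  · subst hJ
    simp [pairCoeff]
    ring
  · have hne : ((J, 0) : ℕ × ℕ) ≠ (0, J) := by simp [hJ]
    have h01 : ((0, J) : ℕ × ℕ) ≠ (J, 0) := fun h => hne h.symm
    rw [Finset.sum_pair hne, Finset.sum_pair hne]
    simp [pairCoeff, hne, h01]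

/-- **Closed form, symmetric version**: for `a, b ≥ 0` with `a - b ∈ ℤ` (either sign),
`taylorCoeffAt x x (m,n) (F^{s}_σ[pairPow a b]) = G¹_a(m) G¹_b(n) + G¹_b(m) G¹_a(n) + σ (G²_a(m) G²_b(n) + G²_b(m) G²_a(n))`,
`Gⁱ_α(m) = factorᵢGerm s α x m` — manifestly symmetric in `a ↔ b` (`pairPow_comm`).
[cite: KosPolandSimmonsduffin2014, §3.3 eq. (3.17)] -/
theorem taylorCoeffAt_crossF_pairPow_symm {x : ℝ} (hx0 : 0 < x) (hx1 : x < 1) (s σ : ℝ)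
    {a b : ℝ} (ha : 0 ≤ a) (hb : 0 ≤ b) (hj : ∃ j : ℤ, a - b = j) (mn : ℕ × ℕ) :
    taylorCoeffAt x x mn (crossF s σ (pairPow a b)) =
      factor₁Germ s a x mn.1 * factor₁Germ s b x mn.2 +
          factor₁Germ s b x mn.1 * factor₁Germ s a x mn.2 +
        σ * (factor₂Germ s a x mn.1 * factor₂Germ s b x mn.2 +
          factor₂Germ s b x mn.1 * factor₂Germ s a x mn.2) := by
  obtain ⟨j, hj⟩ := hj
  rcases le_or_gt b a with hba | hab
  · have hj0 : 0 ≤ j := by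
      have : (0 : ℝ) ≤ (j : ℝ) := by rw [← hj]; linarith
      exact_mod_cast this
    obtain ⟨J, hJ⟩ := Int.eq_ofNat_of_zero_le hj0
    have hjR : (j : ℝ) = ((J : ℕ) : ℝ) := by exact_mod_cast hJ
    have haJ : a = b + (J : ℝ) := by linarith
    subst haJ
    rw [taylorCoeffAt_crossF_pairPow hx0 hx1 s σ hb J mn]
  · have hj0 : 0 ≤ -j := by
      have : (j : ℝ) < 0 := by rw [← hj]; linarith
      have : j < 0 := by exact_mod_cast this
      omega
    obtain ⟨J, hJ⟩ := Int.eq_ofNat_of_zero_le hj0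
    have hjR : ((-j : ℤ) : ℝ) = ((J : ℕ) : ℝ) := by exact_mod_cast hJ
    push_cast at hjR
    have hbJ : b = a + (J : ℝ) := by linarith
    subst hbJ
    rw [show pairPow a (a + (J : ℝ)) = pairPow (a + (J : ℝ)) a from
        funext fun z => funext fun zb => pairPow_comm a (a + (J : ℝ)) z zb,
      taylorCoeffAt_crossF_pairPow hx0 hx1 s σ ha J mn]
    ring

/-- The constant block `1` is half the pair monomial `pairPow 0 0 = 2` (everywhere, `x^0 = 1`).
[folklore] -/
theorem crossF_one_eq_half_pairPow (s σ : ℝ) :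
    crossF s σ (fun _ _ => (1 : ℝ)) = (1 / 2 : ℝ) • crossF s σ (pairPow ((0 : ℝ) + ((0 : ℕ) : ℝ)) 0) := by
  funext z zb
  simp only [Pi.smul_apply, smul_eq_mul, crossF, pairPow, Nat.cast_zero, add_zero, Real.rpow_zero]
  ring

/-- **Closed form on the identity term**: `taylorCoeffAt x x (m,n) (F^{s}_σ[1]) =
c¹_0(m) c¹_0(n) + σ c²_0(m) c²_0(n)` with exponent `b = 0` (`factorᵢGerm s 0 x`). [folklore] -/
theorem taylorCoeffAt_crossF_one {x : ℝ} (hx0 : 0 < x) (hx1 : x < 1) (s σ : ℝ) (mn : ℕ × ℕ) :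
    taylorCoeffAt x x mn (crossF s σ (fun _ _ => (1 : ℝ))) =
      factor₁Germ s 0 x mn.1 * factor₁Germ s 0 x mn.2 +
        σ * (factor₂Germ s 0 x mn.1 * factor₂Germ s 0 x mn.2) := by
  rw [crossF_one_eq_half_pairPow, map_smul, smul_eq_mul,
    taylorCoeffAt_crossF_pairPow hx0 hx1 s σ le_rfl 0 mn]
  simp only [Nat.cast_zero, add_zero]
  ring

/-! ### The typed 2D derivative functional of a finite table -/

/-- **The 2D derivative (Taylor) functional of a finite table** `w` on the index set `S ⊂ ℕ × ℕ` at the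
diagonal point `(x,x)`: `φ = ∑_{(m,n) ∈ S} w_{mn} · taylorCoeffAt x x (m,n)`. With `x = 1/2` and
`w_{mn} = m! n! α_{mn}` this is the readers' `α = ∑ α_{mn} ∂_z^m ∂_z̄^n|_{z=z̄=1/2}` of a
`deriv-functional-2d` certificate. [cite: KosPolandSimmonsduffin2014, §3.3 eq. (3.17)] -/
noncomputable def taylorFunctional2D (x : ℝ) (S : Finset (ℕ × ℕ)) (w : ℕ × ℕ → ℝ) :
    (ℝ → ℝ → ℝ) →ₗ[ℝ] ℝ :=
  ∑ p ∈ S, w p • taylorCoeffAt x x p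

/-- The table functional is a Taylor functional at `(x,x)` (by definition). [folklore] -/
theorem isTaylorFunctional_taylorFunctional2D (x : ℝ) (S : Finset (ℕ × ℕ)) (w : ℕ × ℕ → ℝ) :
    IsTaylorFunctional x x (taylorFunctional2D x S w) :=
  ⟨S, w, rfl⟩

/-- **The table functional on a pair-monomial crossing term**: the finite double sum of the closed
forms. [folklore] -/
theorem taylorFunctional2D_crossF_pairPow {x : ℝ} (hx0 : 0 < x) (hx1 : x < 1)
    (S : Finset (ℕ × ℕ)) (w : ℕ × ℕ → ℝ) (s σ : ℝ) {b : ℝ} (hb : 0 ≤ b) (J : ℕ) :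
    taylorFunctional2D x S w (crossF s σ (pairPow (b + J) b)) =
      ∑ p ∈ S, w p *
        (factor₁Germ s (b + J) x p.1 * factor₁Germ s b x p.2 +
            factor₁Germ s b x p.1 * factor₁Germ s (b + J) x p.2 +
          σ * (factor₂Germ s (b + J) x p.1 * factor₂Germ s b x p.2 +
            factor₂Germ s b x p.1 * factor₂Germ s (b + J) x p.2)) := by
  rw [taylorFunctional2D, LinearMap.sum_apply]
  refine Finset.sum_congr rfl fun p _ => ?_
  rw [LinearMap.smul_apply, smul_eq_mul, taylorCoeffAt_crossF_pairPow hx0 hx1 s σ hb J p]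

/-- **The table functional on the identity term.** [folklore] -/
theorem taylorFunctional2D_crossF_one {x : ℝ} (hx0 : 0 < x) (hx1 : x < 1)
    (S : Finset (ℕ × ℕ)) (w : ℕ × ℕ → ℝ) (s σ : ℝ) :
    taylorFunctional2D x S w (crossF s σ (fun _ _ => (1 : ℝ))) =
      ∑ p ∈ S, w p *
        (factor₁Germ s 0 x p.1 * factor₁Germ s 0 x p.2 +
          σ * (factor₂Germ s 0 x p.1 * factor₂Germ s 0 x p.2)) := by
  rw [taylorFunctional2D, LinearMap.sum_apply]
  refine Finset.sum_congr rfl fun p _ => ?_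
  rw [LinearMap.smul_apply, smul_eq_mul, taylorCoeffAt_crossF_one hx0 hx1 s σ p]

/-! ### The above-threshold obligation from its integer-spaced instances -/

/-- **`PairPositiveAbove` from the instances `a = b + J`**: the pair-monomial obligation above `E₀`
holds as soon as `φ[F_-[pairPow (b+J) b]] ≥ 0` for all real `b ≥ 0` and `J ∈ ℕ` with `2b + J ≥ E₀`
(the case `a < b` by `pairPow_comm`). For `φ = taylorFunctional2D x S w` each instance is the explicit
finite inequality of `taylorFunctional2D_crossF_pairPow`. [cite: RattazziEtAl2008, §5.5] -/
theorem pairPositiveAbove_of_nat {φ : (ℝ → ℝ → ℝ) →ₗ[ℝ] ℝ} {s E₀ : ℝ}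
    (h : ∀ (b : ℝ) (J : ℕ), 0 ≤ b → E₀ ≤ 2 * b + J →
      0 ≤ φ (crossF s (-1) (pairPow (b + J) b))) :
    PairPositiveAbove φ s E₀ := by
  intro a b ha hb hE hj
  obtain ⟨j, hj⟩ := hj
  rcases le_or_gt b a with hba | hab
  · -- `a = b + J` with `J = j ≥ 0`
    have hj0 : 0 ≤ j := by
      have : (0 : ℝ) ≤ (j : ℝ) := by rw [← hj]; linarith
      exact_mod_cast this
    obtain ⟨J, hJ⟩ := Int.eq_ofNat_of_zero_le hj0
    have hjR : (j : ℝ) = ((J : ℕ) : ℝ) := by exact_mod_cast hJ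
    have haJ : a = b + (J : ℝ) := by linarith
    rw [haJ]
    exact h b J hb (by linarith)
  · -- `b = a + J` with `J = -j > 0`
    have hj0 : 0 ≤ -j := by
      have : (j : ℝ) < 0 := by rw [← hj]; linarith
      have : j < 0 := by exact_mod_cast this
      omega
    obtain ⟨J, hJ⟩ := Int.eq_ofNat_of_zero_le hj0
    have hjR : ((-j : ℤ) : ℝ) = ((J : ℕ) : ℝ) := by exact_mod_cast hJ
    push_cast at hjR
    have hbJ : b = a + (J : ℝ) := by linarith
    rw [show pairPow a b = pairPow b a from funext fun z => funext fun zb => pairPow_comm a b z zb,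
      hbJ]
    exact h a J ha (by linarith)

/-! ### Cells below `E₀`: the truncation bound for Taylor functionals -/

/-- **Truncation for a Taylor functional** (twin of `phi_QN_le_block`): with the above-threshold
obligation `PairPositiveAbove φ s E₀`, every block with `ℓ ≤ Δ` and `Δ + N ≥ E₀` satisfies
`φ[F_-[Q_N]] ≤ φ[F_-[g_{Δ,ℓ}]]` — `φ` acts term by term on the pair-monomial series
(`hasSummableGerms_pairPow`) and the dropped pairs are non-negative. PROVED. [folklore] -/
theorem phi_QN_le_block_taylor {φ : (ℝ → ℝ → ℝ) →ₗ[ℝ] ℝ} {s x E₀ : ℝ}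
    (hφ : IsTaylorFunctional x x φ) (hx0 : 0 < x) (hx1 : x < 1)
    (hpair : PairPositiveAbove φ s E₀) {Δ : ℝ} {ℓ N : ℕ} (hΔ : (ℓ : ℝ) ≤ Δ) (hN : E₀ ≤ Δ + N) :
    φ (crossF s (-1) (QN N ℓ Δ)) ≤ φ (crossF s (-1) (globalBlock Δ ℓ)) := by
  have hℓ : (0 : ℝ) ≤ ℓ := Nat.cast_nonneg ℓ
  have hr : 0 < x * (1 - x) := mul_pos hx0 (by linarith)
  have hρ0 : 0 < x * (1 - x) / 2 := by positivity
  have hρ : x * (1 - x) / 2 < x * (1 - x) := by linarith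
  have hs := hφ.hasSum_mul_of_hasSummableGerms hρ0 (hasSummableGerms_pairPow hΔ s hx0 hx1 hρ0 hρ)
    (crossF s (-1) (globalBlock Δ ℓ)) (fun h' k hh hk =>
      hasSum_crossF_globalBlock hΔ (mem_Ioo_of_abs_lt (hh.trans hρ)) (mem_Ioo_of_abs_lt (hk.trans hρ)))
  rw [← TN_eq_phi_QN, ← Finset.sum_product (s := range N) (t := range N)
    (f := fun mm : ℕ × ℕ => chiralCoeff ((Δ + ℓ) / 2) mm.1 * chiralCoeff ((Δ - ℓ) / 2) mm.2 *
      φ (crossF s (-1) (pairPow ((Δ + ℓ) / 2 + mm.1) ((Δ - ℓ) / 2 + mm.2))))]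
  refine sum_le_hasSum (range N ×ˢ range N) (fun mm hmm => ?_) hs
  have hout : N ≤ mm.1 ∨ N ≤ mm.2 := by
    simp only [Finset.mem_product, Finset.mem_range, not_and_or, not_lt] at hmm
    exact hmm
  refine mul_nonneg (mul_nonneg (chiralCoeff_nonneg (by linarith) _) (chiralCoeff_nonneg (by linarith) _))
    (hpair _ _ ?_ ?_ ?_ ⟨(ℓ : ℤ) + mm.1 - mm.2, ?_⟩)
  · have : (0 : ℝ) ≤ mm.1 := Nat.cast_nonneg _; linarith
  · have : (0 : ℝ) ≤ mm.2 := Nat.cast_nonneg _; linarith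
  · have h1 : (0 : ℝ) ≤ mm.1 := Nat.cast_nonneg _
    have h2 : (0 : ℝ) ≤ mm.2 := Nat.cast_nonneg _
    rcases hout with h | h
    · have : (N : ℝ) ≤ mm.1 := by exact_mod_cast h
      linarith
    · have : (N : ℝ) ≤ mm.2 := by exact_mod_cast h
      linarith
  · push_cast; ring

/-- **(C) from the truncated block, Taylor functional**: `φ[F_-[Q_N]] ≥ 0 ⇒ φ[F_-[g_{Δ,ℓ}]] ≥ 0`.
PROVED. [folklore] -/
theorem blockPositive_of_QN_nonneg_taylor {φ : (ℝ → ℝ → ℝ) →ₗ[ℝ] ℝ} {s x E₀ : ℝ}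
    (hφ : IsTaylorFunctional x x φ) (hx0 : 0 < x) (hx1 : x < 1)
    (hpair : PairPositiveAbove φ s E₀) {Δ : ℝ} {ℓ N : ℕ} (hΔ : (ℓ : ℝ) ≤ Δ)
    (hN : E₀ ≤ Δ + N) (h : 0 ≤ φ (crossF s (-1) (QN N ℓ Δ))) : BlockPositive φ s Δ ℓ :=
  h.trans (phi_QN_le_block_taylor hφ hx0 hx1 hpair hΔ hN)

/-- **The table functional on the truncated block** `Q_N` (`ℓ ≤ Δ`): the explicit finite triple sum
`∑_{m,m'<N} a_m(h) a_{m'}(h̄) ∑_{p∈S} w_p [G¹_{h+m}(p₁) G¹_{h̄+m'}(p₂) + G¹_{h̄+m'}(p₁) G¹_{h+m}(p₂) -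
(G² likewise)]` — the expression a kernel cell checker bounds from below on each `Δ`-cell for a 2D
γ-certificate. [folklore] -/
theorem taylorFunctional2D_crossF_QN {x : ℝ} (hx0 : 0 < x) (hx1 : x < 1)
    (S : Finset (ℕ × ℕ)) (w : ℕ × ℕ → ℝ) (s : ℝ) {Δ : ℝ} {ℓ : ℕ} (hΔ : (ℓ : ℝ) ≤ Δ) (N : ℕ) :
    taylorFunctional2D x S w (crossF s (-1) (QN N ℓ Δ)) =
      ∑ m ∈ range N, ∑ m' ∈ range N,
        chiralCoeff ((Δ + ℓ) / 2) m * chiralCoeff ((Δ - ℓ) / 2) m' *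
          ∑ p ∈ S, w p *
            (factor₁Germ s ((Δ + ℓ) / 2 + m) x p.1 * factor₁Germ s ((Δ - ℓ) / 2 + m') x p.2 +
                factor₁Germ s ((Δ - ℓ) / 2 + m') x p.1 * factor₁Germ s ((Δ + ℓ) / 2 + m) x p.2 +
              (-1) * (factor₂Germ s ((Δ + ℓ) / 2 + m) x p.1 * factor₂Germ s ((Δ - ℓ) / 2 + m') x p.2 +
                factor₂Germ s ((Δ - ℓ) / 2 + m') x p.1 * factor₂Germ s ((Δ + ℓ) / 2 + m) x p.2)) := by
  have hℓ : (0 : ℝ) ≤ ℓ := Nat.cast_nonneg ℓ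
  rw [← TN_eq_phi_QN]
  refine Finset.sum_congr rfl fun m _ => Finset.sum_congr rfl fun m' _ => ?_
  congr 1
  rw [taylorFunctional2D, LinearMap.sum_apply]
  refine Finset.sum_congr rfl fun p _ => ?_
  rw [LinearMap.smul_apply, smul_eq_mul, taylorCoeffAt_crossF_pairPow_symm hx0 hx1 s (-1) ?_ ?_
    ⟨(ℓ : ℤ) + m - m', ?_⟩ p]
  · have : (0 : ℝ) ≤ m := Nat.cast_nonneg _; linarith
  · have : (0 : ℝ) ≤ m' := Nat.cast_nonneg _; linarith
  · push_cast; ring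

end Summit.CriticalPhenomena.Ising3D.Control2D
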